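import Summits.BirchSwinnertonDyer.Rank1Residual.GaloisImage.PropagatedConditionCoisotropicInduced
import Summits.BirchSwinnertonDyer.Rank1Residual.GaloisImage.SakamotoN11Instance
import Summits.BirchSwinnertonDyer.Rank1Residual.GaloisImage.InflationRestrictionSakamotoH3
import HarnessLib

/-!
# The N11 instance of Sakamoto 2024 Thm. 4.4 (1) for `(E[3^{k+1}], 𝓕_can)` with (H.SD) and the
# residual coisotropy DISCHARGED — cell `b2b-bsdres`, team n1011, row T-a3-F1 (hypothesis side),
# deal R5-3 (p18: residual coisotropy); consumer of p13's `SakamotoN11Instance.lean` (p255331) and of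
# `PropagatedConditionCoisotropicInduced.lean`

HONEST FRAMING (cell `b2b-bsdres`, run/shared/lean/b2b/bsd-rank1-residual/, verbatim in every
file): the goal of the cell is to DELETE the COMBINATION-SHAPED residual classes of the
Birch–Swinnerton-Dyer formula for ALL analytic-rank `≤ 1` elliptic curves over `ℚ` — "full BSD
formula for every rank `≤ 1` curve in class `C`" assembled STRICTLY from published theorems — so
that the rank-`≤ 1` remainder becomes exactly the CONSTRUCTION-SHAPED classes, which are TYPED
(missing-input `Prop`s), NOT attempted. This is not "finishing BSD". Team n1011 (N10/N11, the
additive block `X4 ∧ p = 3`): research route; no claim beyond the stated classes; the label X4 and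
the mark of RESIDUAL-MAP §I N11 are UNCHANGED by this file; nothing is booked. One theorem, no
definition, no named fact introduced; the end theorem is CONDITIONAL on the tree's named fact
`Literature.NumberTheory.GaloisCohomology.Sakamoto2024.kolyvaginSystems_freeRankOne_zmod_three_pow`
(R. Sakamoto, JTNB 36 (2024) Thm. 4.4 (1); hypothesis `hS24`, debt of the tree) exactly as p13's
instance, and takes Tate's local Euler–Poincaré characteristic (named fact
`localEulerPoincareCharacteristic ℚ_v`, Milne *ADT* I Thm. 2.8) as the explicit hypothesis `hEP`.

## What this file proves

p13's `kolyvaginSystems_freeRankOne_propagatedSelmerStructure` (the N11 instance of the fact: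
`KS₁(E[3^{k+1}], 𝓕_can, 𝒫)` free of rank one over `ℤ/3^{k+1}`, `𝓕_can = propagatedSelmerStructure W 3 k`
the Mazur–Rubin structure propagated from `T₃E`) keeps, among its explicit binders, the
self-duality datum `θ : E[3] → E[3]^∨(1)` with (H.SD) `hθ : Bijective θ` and the residual
coisotropy `hco : inv.IsResiduallyCoisotropic (propagatedSelmerStructureOne W 3) θ S`
(Sakamoto Def. 3.8) "to stay agnostic of the Weil data".  Since `θ` occurs in no other binder and
not in the conclusion, it can be CHOSEN: here `θ :=` the Weil dual map `weilDualIntertwining W 3 e …`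
of a Weil pairing `e` on `E[3]`, which exists (`exists_weilPairing_holds`, Silverman *AEC* III.8.1),
is bijective (`X11b.LocBridge.weilDualHom_bijective`), and for which `𝓕̄_can` is residually
coisotropic on every finite `S` given `hEP` (`isResiduallyCoisotropic_propagatedSelmerStructureOne_three`,
n1011-p18).  Result: `kolyvaginSystems_freeRankOne_propagatedSelmerStructure_weil` — the same
conclusion with `θ`, `hθ`, `hco` and the `[Finite E[3^k·3]]` binder gone and `hEP` added; every
other binder is p13's verbatim, in particular **core rank one of `𝓕̄_can`** (`hCR`, the located
gap (Lp), cells/n1011/skel/T-a3-F1-CR.md) stays explicit.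

References: R. Sakamoto, JTNB 36 (2024) 919–946, Def. 3.8, Thm. 4.4 [Sakamoto2024]; J. H. Silverman,
*The Arithmetic of Elliptic Curves*, Prop. III.8.1 [SilvermanAEC2009]; J. S. Milne, *Arithmetic
Duality Theorems* (2006) I Thm. 2.8 [MilneADT2006].
-/

noncomputable section

open scoped Classical

namespace Summit.BirchSwinnertonDyer.Rank1Residual.GaloisImage

open WeierstrassCurve Field Function NumberField IsDedekindDomain
open Literature.NumberTheory.EllipticCurves Literature.NumberTheory.GaloisRepresentations
open Literature.NumberTheory.GaloisCohomology
open Literature.NumberTheory.GaloisRepresentations.DiscreteGaloisModule (tateDual SelmerStructure)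
open scoped ContRepresentation

/-! ### The N11 instance with (H.SD) and residual coisotropy DISCHARGED (`θ :=` the Weil dual map) -/

section N11Weil

variable (W : WeierstrassCurve ℚ) [W.IsElliptic]

/-- **The N11 instance of Sakamoto's Thm. 4.4 (1) for `(E[3^{k+1}], 𝓕_can)` with the binders
(H.SD) (`θ` bijective) and "residually coisotropic" of p13's
`kolyvaginSystems_freeRankOne_propagatedSelmerStructure` (p255331) DISCHARGED, and no Weil data
in the signature:** `θ` is taken to be the Weil dual map `E[3] → E[3]^∨(1)` of a Weil pairing on
`E[3]` (which EXISTS: `exists_weilPairing_holds`, Silverman III.8.1), bijective by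
`X11b.LocBridge.weilDualHom_bijective`, for which `𝓕̄_can = propagatedSelmerStructureOne W 3` is
residually coisotropic by `isResiduallyCoisotropic_propagatedSelmerStructureOne_three`; the price is
Tate's local Euler–Poincaré characteristic at the finite places of `S` (named fact
`localEulerPoincareCharacteristic ℚ_v`, hypothesis `hEP`).  `θ` occurs in no other binder and
not in the conclusion, so nothing is lost by choosing it.  Of the two `Finite` instance binders of
p13's theorem, `[Finite E[3^k·3]]` is discharged (`finite_geomTorsion_pow_mul`) and `[Finite E[3]]`
is kept (the statement needs it; any consumer has it, e.g. `finite_geomTorsion_of_neZero W 3`).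
Every other binder is p13's, verbatim (tower, `τ`, (H.3), the Poitou–Tate family `inv` with its
four properties, `S`, unramifiedness, **core rank one of `𝓕̄_can`** — the located gap (Lp),
skel/T-a3-F1-CR —, the Kolyvagin datum); CONDITIONAL on the named fact `hS24` (Sakamoto 2024
Thm. 4.4 (1), debt of the tree) exactly as p13's theorem.  Nothing booked; no mark changed.
[cite: Sakamoto2024, Def. 3.8 (p. 924) and Thm. 4.4 (p. 926)] -/
theorem kolyvaginSystems_freeRankOne_propagatedSelmerStructure_weil
    (hS24 : Sakamoto2024.kolyvaginSystems_freeRankOne_zmod_three_pow) (k : ℕ)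
    [Finite (geomTorsion W ((3 : ℕ) : ℤ))]
    (htower : ∀ n : ℕ, W.HasSurjectiveModNGaloisRep (3 ^ n : ℕ))
    (τ : absoluteGaloisGroup ℚ) (hτμ : τ ∈ rootsOfUnityFixer ℚ (3 ^ (k + 1)))
    (hτq : Nonempty (cokerSubOne (W.torsionGaloisModule (((3 : ℕ) : ℤ) ^ k * ((3 : ℕ) : ℤ))) τ ≃+
      ZMod (3 ^ (k + 1))))
    (hH3 : ∀ f : contOneCocycles (W.torsionGaloisModule ((3 : ℕ) : ℤ)).toTopRep,
      (∀ u : absoluteGaloisGroup ℚ, (W.torsionGaloisModule (((3 : ℕ) : ℤ) ^ k * ((3 : ℕ) : ℤ))) u = 1 →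
        u ∈ rootsOfUnityFixer ℚ (3 ^ (k + 1)) → f.1 u = 0) →
        oneCocycleClass (W.torsionGaloisModule ((3 : ℕ) : ℤ)).toTopRep f = 0)
    (inv : LocalInvariants ℚ 3) (hperf : inv.IsPerfect) (hsum : inv.SumLocalTermEqZero)
    (hunro : inv.UnramifiedOrthogonal) (hcompl : inv.SelmerComplement)
    (S : Finset (Place ℚ)) (hS : ∀ w : InfinitePlace ℚ, (Sum.inl w : Place ℚ) ∈ S)
    (hS' : ∀ v : HeightOneSpectrum (𝓞 ℚ), (Sum.inr v : Place ℚ) ∉ S →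
      ((3 : ℕ) : 𝓞 ℚ) ∉ v.asIdeal ∧ GaloisRep.IsUnramifiedAt v
        (W.torsionGaloisModule (((3 : ℕ) : ℤ) ^ k * ((3 : ℕ) : ℤ))))
    (hunr : (propagatedSelmerStructure W 3 k).IsUnramifiedOutside S)
    (hEP : ∀ v : HeightOneSpectrum (𝓞 ℚ), (Sum.inr v : Place ℚ) ∈ S →
      localEulerPoincareCharacteristic (v.adicCompletion ℚ))
    (hCR : LocalInvariants.HasCoreRank inv (propagatedSelmerStructureOne W 3) 3 1)
    (D : KolyvaginDatum (W.torsionGaloisModule (((3 : ℕ) : ℤ) ^ k * ((3 : ℕ) : ℤ))))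
    (η : (q : HeightOneSpectrum (𝓞 ℚ)) → (ZMod (Ideal.absNorm q.asIdeal))ˣ)
    (hP : D.primes = frobeniusClassPrimes (W.torsionGaloisModule (((3 : ℕ) : ℤ) ^ k * ((3 : ℕ) : ℤ)))
      {v | (Sum.inr v : Place ℚ) ∈ S} τ (3 ^ (k + 1)))
    (hT : D.transverse =
      cyclotomicTransverse (W.torsionGaloisModule (((3 : ℕ) : ℤ) ^ k * ((3 : ℕ) : ℤ))))
    (hD : D.HasCanonicalComparison (3 ^ (k + 1)) η) :
    KolyvaginSystem.IsFreeRankOneZMod (D.kolyvaginSystems (propagatedSelmerStructure W 3 k))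
        (3 ^ (k + 1)) ∧
      ∀ (d : Finset (HeightOneSpectrum (𝓞 ℚ))) (hd : D.IsLevel d),
        LocalInvariants.lambdaStar inv ((D.atLevel (propagatedSelmerStructure W 3 k) d).induced
          (W.torsionMulBy (((3 : ℕ) : ℤ) ^ k) ((3 : ℕ) : ℤ))) 3 = 0 →
        Function.Bijective fun κ : D.kolyvaginSystems (propagatedSelmerStructure W 3 k) =>
          (⟨κ.1 d, ((KolyvaginDatum.mem_kolyvaginSystems_iff D _ κ.1).mp κ.2).mem_selmerGroup
              d hd⟩ : (D.atLevel (propagatedSelmerStructure W 3 k) d).selmerGroup) := by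
  haveI := finite_geomTorsion_pow_mul W 3 k
  obtain ⟨e, hμ, hadd₁, hadd₂, halt, hnondeg, hgal⟩ :=
    exists_weilPairing_holds W 3 (by norm_num) (by norm_num)
  exact kolyvaginSystems_freeRankOne_propagatedSelmerStructure W hS24 k htower τ hτμ hτq hH3
    (weilDualIntertwining W 3 e hμ hadd₁ hadd₂ hgal)
    (X11b.LocBridge.weilDualHom_bijective W 3 e hμ hadd₁ hadd₂ hnondeg)
    inv hperf hsum hunro hcompl S hS hS' hunr hCR
    (isResiduallyCoisotropic_propagatedSelmerStructureOne_three W e hμ hadd₁ hadd₂ hgal halt hnondeg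
      inv hperf S hEP)
    D η hP hT hD

end N11Weil

/-! ### (H.3) discharged too: the instance from the `3`-adic tower, `τ`, the Poitou–Tate family,
### `S`, Tate's local Euler characteristic, the core rank and the Kolyvagin datum -/

section N11WeilH3

variable (W : WeierstrassCurve ℚ) [W.IsElliptic]

/-- **The N11 instance with (H.SD), "residually coisotropic" AND (H.3) discharged.**  The binder
`hH3` of `kolyvaginSystems_freeRankOne_propagatedSelmerStructure_weil` ((H.3) at level `3^{k+1}`
in the fact's inflation–restriction form: every continuous crossed homomorphism `Γ_ℚ → E[3]`
vanishing on `ker ρ̄_{E,3^{k+1}} ∩ Γ_{ℚ(μ_{3^{k+1}})}` is principal) is a THEOREM under the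
`3`-adic tower hypothesis `htower` already present: n1011-p04's
`hH3_three_of_towerSurj` (`InflationRestrictionSakamotoH3.lean`, p256623; inflation–restriction
with `H¹(GL₂(ℤ/3^{k+1}), E[3]) = 0`).  Remaining explicit binders: the fact `hS24`, the level `k`,
`[Finite E[3]]`, the tower `htower`, the (H.2) datum `τ` (`hτμ`, `hτq` — supplied by
`exists_rootsOfUnityFixer_cokerSubOne_equiv_of_towerSurj`, entered as data because Sakamoto's
prime set depends on it), the Poitou–Tate family `inv` with its four properties, `S` with `hS`,
`hS'`, `hunr`, Tate's local Euler–Poincaré characteristic `hEP` at the finite places of `S`,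
**core rank one `hCR`** (the located gap (Lp); p13's `PropagatedStructureCoreRank.lean`), and the
Kolyvagin datum `D`, `η`, `hP`, `hT`, `hD`.  CONDITIONAL on `hS24` exactly as p13's theorem;
nothing booked, no mark changed. [cite: Sakamoto2024, §2 (H.3), Def. 3.8 and Thm. 4.4 (pp. 921–926)] -/
theorem kolyvaginSystems_freeRankOne_propagatedSelmerStructure_of_towerSurj
    (hS24 : Sakamoto2024.kolyvaginSystems_freeRankOne_zmod_three_pow) (k : ℕ)
    [Finite (geomTorsion W ((3 : ℕ) : ℤ))]
    (htower : ∀ n : ℕ, W.HasSurjectiveModNGaloisRep (3 ^ n : ℕ))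
    (τ : absoluteGaloisGroup ℚ) (hτμ : τ ∈ rootsOfUnityFixer ℚ (3 ^ (k + 1)))
    (hτq : Nonempty (cokerSubOne (W.torsionGaloisModule (((3 : ℕ) : ℤ) ^ k * ((3 : ℕ) : ℤ))) τ ≃+
      ZMod (3 ^ (k + 1))))
    (inv : LocalInvariants ℚ 3) (hperf : inv.IsPerfect) (hsum : inv.SumLocalTermEqZero)
    (hunro : inv.UnramifiedOrthogonal) (hcompl : inv.SelmerComplement)
    (S : Finset (Place ℚ)) (hS : ∀ w : InfinitePlace ℚ, (Sum.inl w : Place ℚ) ∈ S)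
    (hS' : ∀ v : HeightOneSpectrum (𝓞 ℚ), (Sum.inr v : Place ℚ) ∉ S →
      ((3 : ℕ) : 𝓞 ℚ) ∉ v.asIdeal ∧ GaloisRep.IsUnramifiedAt v
        (W.torsionGaloisModule (((3 : ℕ) : ℤ) ^ k * ((3 : ℕ) : ℤ))))
    (hunr : (propagatedSelmerStructure W 3 k).IsUnramifiedOutside S)
    (hEP : ∀ v : HeightOneSpectrum (𝓞 ℚ), (Sum.inr v : Place ℚ) ∈ S →
      localEulerPoincareCharacteristic (v.adicCompletion ℚ))
    (hCR : LocalInvariants.HasCoreRank inv (propagatedSelmerStructureOne W 3) 3 1)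
    (D : KolyvaginDatum (W.torsionGaloisModule (((3 : ℕ) : ℤ) ^ k * ((3 : ℕ) : ℤ))))
    (η : (q : HeightOneSpectrum (𝓞 ℚ)) → (ZMod (Ideal.absNorm q.asIdeal))ˣ)
    (hP : D.primes = frobeniusClassPrimes (W.torsionGaloisModule (((3 : ℕ) : ℤ) ^ k * ((3 : ℕ) : ℤ)))
      {v | (Sum.inr v : Place ℚ) ∈ S} τ (3 ^ (k + 1)))
    (hT : D.transverse =
      cyclotomicTransverse (W.torsionGaloisModule (((3 : ℕ) : ℤ) ^ k * ((3 : ℕ) : ℤ))))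
    (hD : D.HasCanonicalComparison (3 ^ (k + 1)) η) :
    KolyvaginSystem.IsFreeRankOneZMod (D.kolyvaginSystems (propagatedSelmerStructure W 3 k))
        (3 ^ (k + 1)) ∧
      ∀ (d : Finset (HeightOneSpectrum (𝓞 ℚ))) (hd : D.IsLevel d),
        LocalInvariants.lambdaStar inv ((D.atLevel (propagatedSelmerStructure W 3 k) d).induced
          (W.torsionMulBy (((3 : ℕ) : ℤ) ^ k) ((3 : ℕ) : ℤ))) 3 = 0 →
        Function.Bijective fun κ : D.kolyvaginSystems (propagatedSelmerStructure W 3 k) =>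
          (⟨κ.1 d, ((KolyvaginDatum.mem_kolyvaginSystems_iff D _ κ.1).mp κ.2).mem_selmerGroup
              d hd⟩ : (D.atLevel (propagatedSelmerStructure W 3 k) d).selmerGroup) :=
  kolyvaginSystems_freeRankOne_propagatedSelmerStructure_weil W hS24 k htower τ hτμ hτq
    (hH3_three_of_towerSurj W k htower) inv hperf hsum hunro hcompl S hS hS' hunr hEP hCR D η hP hT hD

end N11WeilH3

end Summit.BirchSwinnertonDyer.Rank1Residual.GaloisImage

end
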